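import Summits.QuantumFields.BalabanUV.Beta.MultiscaleRemainderLeibniz
import Summits.QuantumFields.BalabanUV.Beta.MultiscalePartitionNormalize

/-!
# Beta / MultiscaleRemainderL2 — NODE (w4-b) OF THE O.2 SKELETON §8.9: THE LEVEL-FREE ℓ² BOUND OF ONE PARAMETRIX
# REMAINDER TERM K(h)G′_{Ω₀}M_h FOR Δ_U + Σ_j a_jG_jᵀG_j FROM THREE LOCAL DATA (MODEL; any site/bond structure)

With the algebra of `MultiscaleRemainderLeibniz` (`K_Q(h) = (leibRemT h + leibRemRT h) ∘ ∇_U + M_{Δ_c h} + [M_h, Q]`),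
this module proves, with every constant explicit:
* §1 the DIRICHLET INVERSE UNDER LOCAL COERCIVITY: if `λ·Σf² ≤ ⟨f, Af⟩` for the fields supported in `Ω₀ = {χ = 1}`
  then `G′ = dirInv A χ` has `‖G′‖ ≤ λ⁻¹` AND the ENERGY bound `‖D ∘ G′‖ ≤ λ^{−1/2}` for every `D` whose Dirichlet form
  `A` dominates (`⟨G′v, AG′v⟩ = ⟨G′v, v⟩` from `Ω₀AΩ₀G′ = Ω₀`; for `A = levelOp`: `Σ(∇_Uf)² ≤ ⟨f, Af⟩`, pv21
  `qform_levelOp`) — the Dirichlet problem on a hull sees only the coercivity OF THE HULL;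
* §2 the commutator `[GᵀG, M_φ]` bounded by the block oscillation of `φ` ONLY WHERE THE SITE WEIGHT IS NONZERO
  (`l2Bound_comm_gMeanSq_supp`; level-sum version `l2Bound_comm_levelSum_supp` with PER-LEVEL weights, block sizes and
  oscillations) — the levels whose weighted cells do not meet the region where `h` varies contribute nothing;
* §3 the ASSEMBLY **`l2Bound_remK_dirInv`**:
  `‖K(h)∘G′∘M_h‖ ≤ 2θ√z·(√λ)⁻¹ + (Θ₂ + Σ_j |a_j|·2w_j²n_j·m_j)·λ⁻¹`
  for `|h| ≤ 1`, `|c∂h| ≤ θ`, `|Δ_c h| ≤ Θ₂`, `|h − h̄_j∘blk_j| ≤ m_j` where `W_j ≠ 0`.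
With scale-adapted data (`θ ≍ c/(MS)`, `Θ₂ ≍ c²/(MS)²`, `λ ≍ κ/(LS)²`, `m_j ≍ dS_j/(MS)` on the `≤ 3` levels meeting the
bump, `a_jw_j²n_j ≤ a_max/S_j²`) every summand is `O(1/M)` uniformly in the scale `S`, the level count and the volume —
the LEVEL-FREE per-box half of the [B9] (3.89) / [B6] (2.38) smallness (the torus/cell-family instance is node (w4-b′),
separate; unit `b2b-balaban-beta-d4-p2`, GEN 9, MODEL crew; O.2 skeleton v1.4.1 §8.9 (w4-b); gen-4
`CovariantTowerRemainder` pattern with LOCAL constants).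

HONEST FRAMING: discharging `BetaPertH` makes Bałaban's UV stability UNCONDITIONAL — NOT the continuum limit, NOT the
Clay problem.  HONEST DEPENDENCY (verbatim): «continuum YM on T⁴ ⇐ BetaPertH ∧ nine spine estimates (0/9 proved);
BetaPertH ⇐ (D1) ∧ (D4) ∧ CAP+tail; G-an2-4 gates asym, D1 and NE2/3/4.»  THIS MODULE DISCHARGES NOTHING of `BetaPertH`,
asserts NOTHING printed and cites nothing as a fact (ABSOLUTE RULE): [folklore] Cauchy–Schwarz (gen-8
`MultiscalePartitionNormalize.sum_mul_le_sqrt_mul_sqrt` BY NAME) and operator algebra about the pv21 component MODEL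
(`gMean`, `levelSum`, `levelOp`, `dirInv`).  LOCI (shape only): [B9] =
`Balaban1985BackgroundPropagators` (3.88)–(3.89) p. 409, p. 394 (G′), (3.42) p. 397; [B6] = `Balaban1984PropagatorsII`
(2.37)–(2.40), (2.43) pp. 229–230.  No class change on row D4 (critical-path width 0; D4 DISCHARGE NO DATE); NOT
BetaPertH, NOT continuum, NOT Clay, NOT summit progress.
-/

namespace Summit.QuantumFields.BalabanUV.Beta.MultiscaleRemainderL2

open Finset
open Literature.MathematicalPhysics.QuantumFieldTheory.Balaban1983to89
open B9Thm37Sum B9Thm37Glue B9Thm37GlueTorusInv B9Thm37GlueTorusCov B9Thm37GlueTorusCovComp B9Thm37GlueTorusCovLevels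
open Summit.QuantumFields.BalabanUV.Beta.CovariantTowerL2
open Summit.QuantumFields.BalabanUV.Beta.MultiscaleRemainderLeibniz

noncomputable section

/-! ## §1  The Dirichlet inverse under LOCAL coercivity: ‖G′‖ ≤ λ⁻¹ and the energy bound -/

section Dirichlet

variable {X : Type} [Fintype X]

omit [Fintype X] in
/-- `G′v` lives on `Ω₀`: `χ·(G′v) = G′v` pointwise. [folklore] -/
theorem mul_dirInv_apply (A : Module.End ℝ (X → ℝ)) {χ : X → ℝ} (hχ : ∀ x, χ x = 0 ∨ χ x = 1) (v : X → ℝ) (x : X) :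
    χ x * dirInv A χ v x = dirInv A χ v x := by
  have e := congrArg (fun T : Module.End ℝ (X → ℝ) => T v x) (mulOp_mul_dirInv_mul_mulOp A hχ)
  simp only [Module.End.mul_apply, mulOp_apply] at e
  -- e : χ x * (dirInv A χ (mulOp χ v)) x = dirInv A χ v x; but also dirInv A χ = χ R χ so dirInv (χ v) = dirInv v
  have e2 : dirInv A χ (mulOp χ v) = dirInv A χ v := by
    have := congrArg (fun T : Module.End ℝ (X → ℝ) => T v) (show dirInv A χ * mulOp χ = dirInv A χ by
      rw [dirInv, mul_assoc, mulOp_idem hχ])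
    simpa only [Module.End.mul_apply] using this
  rw [e2] at e
  exact e

omit [Fintype X] in
/-- `G′v` vanishes off `Ω₀`. [folklore] -/
theorem dirInv_apply_eq_zero (A : Module.End ℝ (X → ℝ)) {χ : X → ℝ} (hχ : ∀ x, χ x = 0 ∨ χ x = 1) (v : X → ℝ)
    {x : X} (hx : χ x = 0) : dirInv A χ v x = 0 := by
  rw [← mul_dirInv_apply A hχ v x, hx, zero_mul]

/-- **The energy identity of the Dirichlet inverse**: `⟨G′v, A(G′v)⟩ = ⟨G′v, v⟩` for strictly positive `A` and a
characteristic `χ` (`Ω₀AΩ₀G′ = Ω₀` and `Ω₀G′ = G′`). [cite: Balaban1985BackgroundPropagators, p.394 (G′ = the inverse of Ω₀Δ′_aΩ₀) + p.395] -/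
theorem qform_dirInv_eq (A : Module.End ℝ (X → ℝ)) (hA : ∀ f : X → ℝ, f ≠ 0 → 0 < ∑ x, f x * A f x) {χ : X → ℝ}
    (hχ : ∀ x, χ x = 0 ∨ χ x = 1) (v : X → ℝ) :
    ∑ x, dirInv A χ v x * A (dirInv A χ v) x = ∑ x, dirInv A χ v x * v x := by
  set w := dirInv A χ v with hw
  have hχw : mulOp χ w = w := funext fun x => by rw [mulOp_apply, hw, mul_dirInv_apply A hχ v x]
  have hS := congrArg (fun T : Module.End ℝ (X → ℝ) => T v) (sandwichΩ_mul_dirInv hA hχ)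
  simp only [Module.End.mul_apply] at hS
  -- hS : mulOp χ (A (mulOp χ w)) = mulOp χ v
  rw [← hw, hχw] at hS
  have hwx : ∀ x, χ x * w x = w x := fun x => by rw [hw]; exact mul_dirInv_apply A hχ v x
  calc ∑ x, w x * A w x = ∑ x, w x * (mulOp χ (A w)) x := by
        refine Finset.sum_congr rfl fun x _ => ?_
        rw [mulOp_apply, ← mul_assoc, mul_comm (w x) (χ x), hwx x]
    _ = ∑ x, w x * (mulOp χ v) x := by rw [hS]
    _ = ∑ x, w x * v x := by
        refine Finset.sum_congr rfl fun x _ => ?_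
        rw [mulOp_apply, ← mul_assoc, mul_comm (w x) (χ x), hwx x]

/-- **LOCAL COERCIVITY ⟹ `‖G′v‖ ≤ λ⁻¹‖v‖` AND `⟨G′v, v⟩ ≤ λ⁻¹‖v‖²`** (strictly positive `A`, characteristic `χ`,
`λ·Σf² ≤ ⟨f, Af⟩` for every `f` vanishing off `Ω₀ = {χ = 1}`): the Dirichlet problem on a hull sees only the coercivity
of the hull. [cite: Balaban1985BackgroundPropagators, p.394 + Thm 3.1 p.397; Balaban1984PropagatorsII, (2.43) p.230] -/
theorem dirInv_local (A : Module.End ℝ (X → ℝ)) (hA : ∀ f : X → ℝ, f ≠ 0 → 0 < ∑ x, f x * A f x) {χ : X → ℝ}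
    (hχ : ∀ x, χ x = 0 ∨ χ x = 1) {lam : ℝ} (hlam : 0 < lam)
    (hcoer : ∀ f : X → ℝ, (∀ x, χ x = 0 → f x = 0) → lam * ∑ x, f x ^ 2 ≤ ∑ x, f x * A f x) (v : X → ℝ) :
    ∑ x, dirInv A χ v x ^ 2 ≤ lam⁻¹ ^ 2 * ∑ x, v x ^ 2 ∧
      ∑ x, dirInv A χ v x * v x ≤ lam⁻¹ * ∑ x, v x ^ 2 := by
  set w := dirInv A χ v with hw
  have hsupp : ∀ x, χ x = 0 → w x = 0 := fun x hx => dirInv_apply_eq_zero A hχ v hx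
  have hW0 : 0 ≤ ∑ x, w x ^ 2 := sum_nonneg fun _ _ => sq_nonneg _
  have hV0 : 0 ≤ ∑ x, v x ^ 2 := sum_nonneg fun _ _ => sq_nonneg _
  have h1 : lam * ∑ x, w x ^ 2 ≤ ∑ x, w x * v x := by
    calc lam * ∑ x, w x ^ 2 ≤ ∑ x, w x * A w x := hcoer w hsupp
      _ = ∑ x, w x * v x := qform_dirInv_eq A hA hχ v
  have hcs := MultiscalePartitionNormalize.sum_mul_le_sqrt_mul_sqrt w v
  -- λ√W·√W ≤ √W√V ⟹ λ√W ≤ √V (or W = 0)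
  set a := Real.sqrt (∑ x, w x ^ 2) with ha
  set b := Real.sqrt (∑ x, v x ^ 2) with hb
  have ha0 : 0 ≤ a := Real.sqrt_nonneg _
  have hb0 : 0 ≤ b := Real.sqrt_nonneg _
  have haW : a ^ 2 = ∑ x, w x ^ 2 := Real.sq_sqrt hW0
  have hbV : b ^ 2 = ∑ x, v x ^ 2 := Real.sq_sqrt hV0
  have h2 : lam * a ^ 2 ≤ a * b := by rw [haW]; exact h1.trans hcs
  have h3 : lam * a ≤ b := by
    rcases ha0.eq_or_lt with h0 | hpos
    · rw [← h0, mul_zero]; exact hb0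
    · have : lam * a * a ≤ b * a := by nlinarith
      exact le_of_mul_le_mul_right this hpos
  have h4 : a ≤ lam⁻¹ * b := by
    rw [inv_mul_eq_div, le_div_iff₀' hlam]
    exact h3
  refine ⟨?_, ?_⟩
  · calc ∑ x, w x ^ 2 = a ^ 2 := haW.symm
      _ ≤ (lam⁻¹ * b) ^ 2 := pow_le_pow_left₀ ha0 h4 2
      _ = lam⁻¹ ^ 2 * ∑ x, v x ^ 2 := by rw [mul_pow, hbV]
  · calc ∑ x, w x * v x ≤ a * b := hcs
      _ ≤ (lam⁻¹ * b) * b := mul_le_mul_of_nonneg_right h4 hb0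
      _ = lam⁻¹ * ∑ x, v x ^ 2 := by rw [mul_assoc, ← sq, hbV]

/-- **`‖G′‖ ≤ λ⁻¹` under local coercivity** (`L2Bound` form of `dirInv_local`). [folklore] -/
theorem l2Bound_dirInv_local (A : Module.End ℝ (X → ℝ)) (hA : ∀ f : X → ℝ, f ≠ 0 → 0 < ∑ x, f x * A f x)
    {χ : X → ℝ} (hχ : ∀ x, χ x = 0 ∨ χ x = 1) {lam : ℝ} (hlam : 0 < lam)
    (hcoer : ∀ f : X → ℝ, (∀ x, χ x = 0 → f x = 0) → lam * ∑ x, f x ^ 2 ≤ ∑ x, f x * A f x) :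
    L2Bound (dirInv A χ) lam⁻¹ :=
  ⟨inv_nonneg.mpr hlam.le, fun v => (dirInv_local A hA hχ hlam hcoer v).1⟩

/-- **THE ENERGY BOUND `‖D∘G′‖ ≤ λ^{−1/2}`** for any operator `D` into any finite space with `Σ(Df)² ≤ ⟨f, Af⟩`
(the Dirichlet form dominated by `A`): `Σ_q (D(G′v))(q)² ≤ λ⁻¹·Σ v²`. [folklore] -/
theorem l2Bound_comp_dirInv_local {Y : Type} [Fintype Y] (A : Module.End ℝ (X → ℝ))
    (hA : ∀ f : X → ℝ, f ≠ 0 → 0 < ∑ x, f x * A f x) {χ : X → ℝ} (hχ : ∀ x, χ x = 0 ∨ χ x = 1) {lam : ℝ}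
    (hlam : 0 < lam) (hcoer : ∀ f : X → ℝ, (∀ x, χ x = 0 → f x = 0) → lam * ∑ x, f x ^ 2 ≤ ∑ x, f x * A f x)
    (D : (X → ℝ) →ₗ[ℝ] (Y → ℝ)) (hDA : ∀ f : X → ℝ, ∑ q, D f q ^ 2 ≤ ∑ x, f x * A f x) :
    L2Bound (D ∘ₗ dirInv A χ) (Real.sqrt lam)⁻¹ := by
  refine ⟨inv_nonneg.mpr (Real.sqrt_nonneg _), fun v => ?_⟩
  rw [LinearMap.comp_apply, inv_pow, Real.sq_sqrt hlam.le]
  calc ∑ q, D (dirInv A χ v) q ^ 2 ≤ ∑ x, dirInv A χ v x * A (dirInv A χ v) x := hDA _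
    _ = ∑ x, dirInv A χ v x * v x := qform_dirInv_eq A hA hχ v
    _ ≤ lam⁻¹ * ∑ x, v x ^ 2 := (dirInv_local A hA hχ hlam hcoer v).2

end Dirichlet

section Energy

variable {St Bd Cp J B : Type} [Fintype St] [DecidableEq St] [Fintype Bd] [Fintype Cp]
  [Fintype J] [Fintype B] [DecidableEq B]
  (src tgt : Bd → St) (c : Bd → ℝ) (Rm : Bd → Cp → Cp → ℝ)
  (blk : J → St → B) (W : J → St → ℝ) (T : J → St → Cp → Cp → ℝ)

/-- **The Dirichlet form is dominated by `Δ_U + Σ_j a_jG_jᵀG_j`** (`a ≥ 0`): `Σ_q (∇_Uf)(q)² ≤ ⟨f, levelOp f⟩` — pv21's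
`qform_levelOp`. [cite: Balaban1985BackgroundPropagators, (3.16) p.393 + (3.23)–(3.24) p.394] -/
theorem sum_covD_sq_le_qform_levelOp {a : J → ℝ} (ha : ∀ j, 0 ≤ a j) (f : St × Cp → ℝ) :
    ∑ q, covD src tgt c Rm f q ^ 2 ≤ ∑ p, f p * levelOp src tgt c Rm blk W T a f p := by
  rw [qform_levelOp]
  have e : ∑ q, covD src tgt c Rm f q ^ 2 = ∑ q, covD src tgt c Rm f q * covD src tgt c Rm f q :=
    Finset.sum_congr rfl fun q _ => sq _
  rw [e]
  exact le_add_of_nonneg_right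
    (Finset.sum_nonneg fun j _ => mul_nonneg (ha j) (Finset.sum_nonneg fun q _ => mul_self_nonneg _))

/-- **`‖∇_U ∘ G′‖ ≤ λ^{−1/2}` for the Dirichlet inverse of `levelOp` on a locally coercive hull.**
[cite: Balaban1985BackgroundPropagators, (3.42) p.397 (the ∇_UG′ member) + p.394; Balaban1984PropagatorsII, (2.43) p.230] -/
theorem l2Bound_covD_dirInv_levelOp {a : J → ℝ} (ha : ∀ j, 0 ≤ a j)
    (hA : ∀ f : St × Cp → ℝ, f ≠ 0 → 0 < ∑ p, f p * levelOp src tgt c Rm blk W T a f p)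
    {χ : St × Cp → ℝ} (hχ : ∀ p, χ p = 0 ∨ χ p = 1) {lam : ℝ} (hlam : 0 < lam)
    (hcoer : ∀ f : St × Cp → ℝ, (∀ p, χ p = 0 → f p = 0) →
      lam * ∑ p, f p ^ 2 ≤ ∑ p, f p * levelOp src tgt c Rm blk W T a f p) :
    L2Bound (covD src tgt c Rm ∘ₗ dirInv (levelOp src tgt c Rm blk W T a) χ) (Real.sqrt lam)⁻¹ :=
  l2Bound_comp_dirInv_local _ hA hχ hlam hcoer _ (sum_covD_sq_le_qform_levelOp src tgt c Rm blk W T ha)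

end Energy

/-! ## §2  The commutator [GᵀG, M_φ] by the block oscillation of φ ON THE WEIGHT'S SUPPORT -/

section Comm

variable {St B Cp : Type} [Fintype St] [Fintype B] [DecidableEq B] [Fintype Cp] [DecidableEq Cp]
  (blk : St → B) (W : St → ℝ) (T : St → Cp → Cp → ℝ)

omit [Fintype B] [DecidableEq Cp] in
/-- `G∘M_φ` sees `φ` only where `W ≠ 0`. [folklore] -/
theorem gMean_comp_mulOp_congr {φ φ' : St → ℝ} (h : ∀ x, W x ≠ 0 → φ x = φ' x) :
    gMean blk W T ∘ₗ mulOp (φ ∘ Prod.fst) = gMean blk W T ∘ₗ mulOp (φ' ∘ Prod.fst) := by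
  apply LinearMap.ext
  intro f
  funext q
  rw [LinearMap.comp_apply, LinearMap.comp_apply, gMean_apply, gMean_apply]
  refine Finset.sum_congr rfl fun x _ => ?_
  split_ifs with hx
  · by_cases hW : W x = 0
    · rw [hW, zero_mul, zero_mul]
    · simp only [mulOp_apply, Function.comp_apply, h x hW]
  · rfl

omit [Fintype St] [Fintype B] [DecidableEq B] [DecidableEq Cp] in
/-- `M_φ∘Gᵀ` sees `φ` only where `W ≠ 0`. [folklore] -/
theorem mulOp_comp_gMeanT_congr {φ φ' : St → ℝ} (h : ∀ x, W x ≠ 0 → φ x = φ' x) :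
    mulOp (φ ∘ Prod.fst) ∘ₗ gMeanT blk W T = mulOp (φ' ∘ Prod.fst) ∘ₗ gMeanT blk W T := by
  apply LinearMap.ext
  intro g
  funext p
  rw [LinearMap.comp_apply, LinearMap.comp_apply, mulOp_apply, mulOp_apply, gMeanT_apply, Function.comp_apply,
    Function.comp_apply]
  by_cases hW : W p.1 = 0
  · rw [hW, zero_mul, mul_zero, mul_zero]
  · rw [h p.1 hW]

/-- **THE COMMUTATOR [GᵀG, M_φ] BY THE BLOCK OSCILLATION OF φ WHERE THE WEIGHT IS NONZERO (MODEL)**: with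
`G = gMean blk W T` (`|W| ≤ w_max`, isometric transports, blocks `≤ n` sites) and ANY block function `φ̄` with
`|φ(x) − φ̄(blk x)| ≤ m` at the sites with `W(x) ≠ 0` only: `‖GᵀG∘M_φ − M_φ∘GᵀG‖ ≤ 2w_max²n·m` — a level whose weighted
cells do not meet the region where `φ` varies contributes NOTHING. [folklore] -/
theorem l2Bound_comm_gMeanSq_supp {wmax : ℝ} (hwmax : 0 ≤ wmax) (hW : ∀ x, |W x| ≤ wmax)
    (hT : ∀ x i i', ∑ k, T x k i * T x k i' = if i = i' then (1 : ℝ) else 0)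
    {n : ℕ} (hn : ∀ β, (univ.filter fun x => blk x = β).card ≤ n) (φ : St → ℝ) (φb : B → ℝ) {m : ℝ}
    (hm : 0 ≤ m) (hδ : ∀ x, W x ≠ 0 → |φ x - φb (blk x)| ≤ m) :
    L2Bound ((gMeanT blk W T ∘ₗ gMean blk W T) ∘ₗ mulOp (φ ∘ Prod.fst) -
        mulOp (φ ∘ Prod.fst) ∘ₗ (gMeanT blk W T ∘ₗ gMean blk W T)) (2 * (wmax ^ 2 * n) * m) := by
  classical
  let φ' : St → ℝ := fun x => if W x = 0 then φb (blk x) else φ x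
  have hagree : ∀ x, W x ≠ 0 → φ x = φ' x := fun x hx => by simp only [φ', if_neg hx]
  have hδ' : ∀ x, |φ' x - φb (blk x)| ≤ m := fun x => by
    by_cases hx : W x = 0
    · simp only [φ', if_pos hx, sub_self, abs_zero]; exact hm
    · simp only [φ', if_neg hx]; exact hδ x hx
  have e1 := gMean_comp_mulOp_congr blk W T hagree
  have e2 := mulOp_comp_gMeanT_congr blk W T hagree
  have e : (gMeanT blk W T ∘ₗ gMean blk W T) ∘ₗ mulOp (φ ∘ Prod.fst) -
      mulOp (φ ∘ Prod.fst) ∘ₗ (gMeanT blk W T ∘ₗ gMean blk W T) =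
      (gMeanT blk W T ∘ₗ gMean blk W T) ∘ₗ mulOp (φ' ∘ Prod.fst) -
        mulOp (φ' ∘ Prod.fst) ∘ₗ (gMeanT blk W T ∘ₗ gMean blk W T) := by
    rw [LinearMap.comp_assoc (mulOp (φ ∘ Prod.fst)) (gMean blk W T) (gMeanT blk W T), e1,
      ← LinearMap.comp_assoc (gMean blk W T) (gMeanT blk W T) (mulOp (φ ∘ Prod.fst)), e2,
      ← LinearMap.comp_assoc (mulOp (φ' ∘ Prod.fst)) (gMean blk W T) (gMeanT blk W T),
      LinearMap.comp_assoc (gMean blk W T) (gMeanT blk W T) (mulOp (φ' ∘ Prod.fst))]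
  rw [e]
  exact l2Bound_comm_gMeanSq blk W T hwmax hW hT hn φ' φb hm hδ'

end Comm

section LevelComm

variable {St B Cp J : Type} [Fintype St] [Fintype B] [DecidableEq B] [Fintype Cp] [DecidableEq Cp] [Fintype J]
  (blk : J → St → B) (W : J → St → ℝ) (T : J → St → Cp → Cp → ℝ)

/-- **`‖[M_h, Σ_j a_jG_jᵀG_j]‖ ≤ Σ_j |a_j|·2w_j²n_j·m_j`** with PER-LEVEL weights `|W_j| ≤ w_j`, block sizes `≤ n_j` and
oscillations `|h(x) − h̄_j(blk_j x)| ≤ m_j` required ONLY at the sites with `W_j(x) ≠ 0` (the commutator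
`M_h∘L − L∘M_h`, `L` the level sum; isometric level transports). [folklore] -/
theorem l2Bound_comm_levelSum_supp
    (hT : ∀ j x i i', ∑ k, T j x k i * T j x k i' = if i = i' then (1 : ℝ) else 0)
    {wmax : J → ℝ} (hwmax : ∀ j, 0 ≤ wmax j) (hW : ∀ j x, |W j x| ≤ wmax j)
    {n : J → ℕ} (hn : ∀ j β, (univ.filter fun x => blk j x = β).card ≤ n j) (a : J → ℝ)
    (h : St → ℝ) (hb : J → B → ℝ) {m : J → ℝ} (hm : ∀ j, 0 ≤ m j)
    (hδ : ∀ j x, W j x ≠ 0 → |h x - hb j (blk j x)| ≤ m j) :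
    L2Bound (mulOp (h ∘ Prod.fst) * levelSum blk W T a - levelSum blk W T a * mulOp (h ∘ Prod.fst))
      (∑ j, |a j| * (2 * (wmax j ^ 2 * (n j : ℝ)) * m j)) := by
  set Q : J → Module.End ℝ (St × Cp → ℝ) := fun j => gMeanT (blk j) (W j) (T j) ∘ₗ gMean (blk j) (W j) (T j)
    with hQ
  have hL : levelSum blk W T a = ∑ j, a j • Q j := rfl
  have hcomm : mulOp (h ∘ Prod.fst) * levelSum blk W T a - levelSum blk W T a * mulOp (h ∘ Prod.fst) =
      ∑ j, a j • -(Q j ∘ₗ mulOp (h ∘ Prod.fst) - mulOp (h ∘ Prod.fst) ∘ₗ Q j) := by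
    rw [hL, Finset.mul_sum, Finset.sum_mul, ← Finset.sum_sub_distrib]
    refine Finset.sum_congr rfl fun j _ => ?_
    rw [mul_smul_comm, smul_mul_assoc, neg_sub, smul_sub]
    rfl
  refine L2Bound.of_eq ?_ hcomm.symm
  refine L2Bound.sum univ fun j _ => ?_
  have hbnd := (l2Bound_comm_gMeanSq_supp (blk j) (W j) (T j) (hwmax j) (hW j) (hT j) (hn j) h (hb j) (hm j)
    (hδ j)).neg
  exact hbnd.smul (a j)

end LevelComm

/-! ## §3  Assembly: the level-free remainder bound -/

section Assembly

variable {St Bd Cp J B : Type} [Fintype St] [DecidableEq St] [Fintype Bd] [Fintype Cp] [DecidableEq Cp]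
  [Fintype J] [Fintype B] [DecidableEq B]
  (src tgt : Bd → St) (c : Bd → ℝ) (Rm : Bd → Cp → Cp → ℝ)
  (blk : J → St → B) (W : J → St → ℝ) (T : J → St → Cp → Cp → ℝ)

/-- **THE LEVEL-FREE ℓ² REMAINDER BOUND (MODEL; node (w4-b) of the O.2 skeleton §8.9).**  For
`A = Δ_U + Σ_j a_jG_jᵀG_j` (`levelOp`; isometric bond matrices and level transports, `a ≥ 0`, strictly positive), a
characteristic `χ` on sites × components with LOCAL coercivity `λ·Σf² ≤ ⟨f, Af⟩` on the fields vanishing off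
`Ω₀ = {χ = 1}` (`λ > 0`), and a bump `h` with `|h| ≤ 1`, `|c(b)(∂h)(b)| ≤ θ`, `|(Δ_c h)(x)| ≤ Θ₂`, block oscillations
`|h(x) − h̄_j(blk_j x)| ≤ m_j` where `W_j(x) ≠ 0`, `|W_j| ≤ w_j`, level-`j` blocks of `≤ n_j` sites, at most `z` bonds
starting resp. ending at a site:
**`‖K(h)∘G′∘M_h‖ ≤ 2θ√z·(√λ)⁻¹ + (Θ₂ + Σ_j |a_j|·2w_j²n_j·m_j)·λ⁻¹`**, `G′ = dirInv A χ`, `K(h) = remK (level sum) h`.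
With scale-adapted data each summand is `O(1/M)` uniformly in the scale — the per-box half of [B9] (3.89) / [B6] (2.38)
SHAPE with LOCAL constants. [cite: Balaban1985BackgroundPropagators, (3.88)–(3.89) p.409; Balaban1984PropagatorsII, (2.37)–(2.40) pp.229–230] -/
theorem l2Bound_remK_dirInv (hRm : ∀ b i j, ∑ k, Rm b k i * Rm b k j = if i = j then (1 : ℝ) else 0)
    (hT : ∀ j x i i', ∑ k, T j x k i * T j x k i' = if i = i' then (1 : ℝ) else 0) {a : J → ℝ} (ha : ∀ j, 0 ≤ a j)
    (hA : ∀ f : St × Cp → ℝ, f ≠ 0 → 0 < ∑ p, f p * levelOp src tgt c Rm blk W T a f p)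
    {χ : St × Cp → ℝ} (hχ : ∀ p, χ p = 0 ∨ χ p = 1) {lam : ℝ} (hlam : 0 < lam)
    (hcoer : ∀ f : St × Cp → ℝ, (∀ p, χ p = 0 → f p = 0) →
      lam * ∑ p, f p ^ 2 ≤ ∑ p, f p * levelOp src tgt c Rm blk W T a f p)
    {z : ℕ} (hzs : ∀ x, (univ.filter fun b => src b = x).card ≤ z) (hzt : ∀ x, (univ.filter fun b => tgt b = x).card ≤ z)
    (h : St → ℝ) (hh : ∀ x, |h x| ≤ 1) {θ : ℝ} (hθ : 0 ≤ θ) (hdh : ∀ b, |c b * (h (tgt b) - h (src b))| ≤ θ)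
    {Θ₂ : ℝ} (hΘ₂ : 0 ≤ Θ₂) (hlap : ∀ x, |lapH src tgt c h x| ≤ Θ₂)
    {wmax : J → ℝ} (hwmax : ∀ j, 0 ≤ wmax j) (hW : ∀ j x, |W j x| ≤ wmax j)
    {n : J → ℕ} (hn : ∀ j β, (univ.filter fun x => blk j x = β).card ≤ n j)
    (hb : J → B → ℝ) {m : J → ℝ} (hm : ∀ j, 0 ≤ m j) (hδ : ∀ j x, W j x ≠ 0 → |h x - hb j (blk j x)| ≤ m j) :
    L2Bound (remK src tgt c Rm (levelSum blk W T a) h * dirInv (levelOp src tgt c Rm blk W T a) χ *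
        mulOp (h ∘ Prod.fst))
      (2 * (θ * Real.sqrt z) * (Real.sqrt lam)⁻¹ +
        (Θ₂ + ∑ j, |a j| * (2 * (wmax j ^ 2 * (n j : ℝ)) * m j)) * lam⁻¹) := by
  set A := levelOp src tgt c Rm blk W T a with hAdef
  set G := dirInv A χ with hG
  -- the pieces
  have hP1 : L2Bound (leibRemT (Cp := Cp) src tgt c h + leibRemRT src tgt c Rm h) (θ * Real.sqrt z + θ * Real.sqrt z) :=
    (l2Bound_leibRemT src tgt c h hθ hdh hzs).add (l2Bound_leibRemRT src tgt c Rm hRm h hθ hdh hzt)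
  have hDG : L2Bound (covD src tgt c Rm ∘ₗ G) (Real.sqrt lam)⁻¹ :=
    l2Bound_covD_dirInv_levelOp src tgt c Rm blk W T ha hA hχ hlam hcoer
  have hGb : L2Bound G lam⁻¹ := l2Bound_dirInv_local A hA hχ hlam hcoer
  have hM : L2Bound (mulOp (h ∘ Prod.fst) : Module.End ℝ (St × Cp → ℝ)) 1 := l2Bound_mulOp zero_le_one fun p => hh p.1
  have hLap : L2Bound (mulOp (lapH src tgt c h ∘ Prod.fst) : Module.End ℝ (St × Cp → ℝ)) Θ₂ :=
    l2Bound_mulOp hΘ₂ fun p => hlap p.1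
  have hC := l2Bound_comm_levelSum_supp blk W T hT hwmax hW hn a h hb hm hδ
  have hP2 := hLap.add hC
  -- K = P1 ∘ D + P2, so K∘G∘M = P1∘(D∘G)∘M + P2∘G∘M
  have hdec : remK src tgt c Rm (levelSum blk W T a) h * G * mulOp (h ∘ Prod.fst) =
      ((leibRemT (Cp := Cp) src tgt c h + leibRemRT src tgt c Rm h) ∘ₗ (covD src tgt c Rm ∘ₗ G)) ∘ₗ
          mulOp (h ∘ Prod.fst) +
        ((mulOp (lapH src tgt c h ∘ Prod.fst) +
            (mulOp (h ∘ Prod.fst) * levelSum blk W T a - levelSum blk W T a * mulOp (h ∘ Prod.fst))) ∘ₗ G) ∘ₗ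
          mulOp (h ∘ Prod.fst) := by
    rw [remK_eq src tgt c Rm hRm]
    simp only [Module.End.mul_eq_comp, LinearMap.add_comp, LinearMap.comp_assoc]
  have hT1 := (hP1.comp hDG).comp hM
  have hT2 := (hP2.comp hGb).comp hM
  have htot := hT1.add hT2
  refine (htot.of_eq hdec.symm).mono (le_of_eq ?_)
  ring

end Assembly

end

end Summit.QuantumFields.BalabanUV.Beta.MultiscaleRemainderL2
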